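import Summits.Parity.GeneralizedHardyLittlewood.Theorems.LeeYangFibresRelativeDimOneDefs
import Mathlib

/-!
# Route `LeeYangFibres`, crux `RelativeDimOne` (stmt-Parity-14113), line `SketchIdeator1` =
`translate-amplification`: one-dimensional facts for B4 (`ArchFacts`), auxiliary file

The archimedean weights of the line are `w(H) = vol(I ∩ ⋂_j (I − H_j))` (`volume (meetTranslates I H)`)
for a convex `I ⊆ [-N, N] ⊆ ℝ¹ = (Fin 1 → ℝ)`. This file transfers them to the real line and proves
the interval facts used by `stub_archFacts` (file `LeeYangFibresRelativeDimOneArchFacts.lean`):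

* transfer through the coordinate map `x ↦ x 0` (`MeasureTheory.volume_preserving_funUnique`): with the
  section `J = {y | (fun _ => y) ∈ I}` — an order-connected subset of `[-N, N]`
  (`ordConnected_section`, the registered sub-goal of this file) — `vol(I) = vol(J)` and
  `vol(K_H) = vol {y | ∀ j, y + H'_j ∈ J}` (`volume_eq_volume_section`, `meetTranslates_eq_preimage`,
  `volume_preimage_apply_zero`);
* the sliver `(J − s) \ (J − s')` has diameter, hence length, `≤ |s − s'|` (`volume_shift_diff_le`), so
  the length of `⋂_j (J − c_j)` is `1`-Lipschitz in each shift (`abs_toReal_volume_sections_sub_le`);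
* for `y ∈ J` the number of integers `h ∈ [-2N, 2N]` with `y + h ∈ J` is within `1` of `vol(J)`
  (`card_shifts_bounds`: these `h` form a block `p, …, q` with `[y+p, y+q] ⊆ J ⊆ (y+p-1, y+q+1)`);
* measurability of `⋂_j (J − c_j)` (`measurableSet_sections`).
-/

noncomputable section

open scoped BigOperators Classical Topology ENNReal
open Finset Filter MeasureTheory Literature.NumberTheory.Sieve

namespace Summit.Parity.GeneralizedHardyLittlewood.Cruxes.RelativeDimOne.TranslateAmplification

variable {m : ℕ}

/-! ### Transfer from `ℝ¹ = (Fin 1 → ℝ)` to `ℝ` -/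

/-- Membership in `I ⊆ ℝ¹` is membership of the coordinate in the section `{y | (y) ∈ I}` (a point
of `ℝ¹` is the constant function at its coordinate). -/
theorem mem_iff_apply_zero_mem_section (I : Set (Fin 1 → ℝ)) (x : Fin 1 → ℝ) :
    x ∈ I ↔ x 0 ∈ {y : ℝ | (fun _ : Fin 1 => y) ∈ I} := by
  rw [Set.mem_setOf_eq, show (fun _ : Fin 1 => x 0) = x from funext fun l => congrArg x (Subsingleton.elim 0 l)]

/-- `K_H` is the preimage under the coordinate map of the corresponding set of the section. -/
theorem meetTranslates_eq_preimage (I : Set (Fin 1 → ℝ)) (H : Fin m → ℤ) :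
    meetTranslates I H = (fun x : Fin 1 → ℝ => x 0) ⁻¹'
      {y : ℝ | ∀ j : Fin (m + 1), y + (shiftVec H j : ℝ) ∈ {y : ℝ | (fun _ : Fin 1 => y) ∈ I}} := by
  ext x
  simp only [meetTranslates, Set.mem_setOf_eq, Set.mem_preimage]
  refine forall_congr' fun j => ?_
  rw [show (fun l : Fin 1 => x l + (shiftVec H j : ℝ)) = fun _ => x 0 + (shiftVec H j : ℝ) from
    funext fun l => by rw [Subsingleton.elim l 0]]

/-- The coordinate map `x ↦ x 0` preserves Lebesgue measure (preimage form). -/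
theorem volume_preimage_apply_zero (A : Set ℝ) :
    volume ((fun x : Fin 1 → ℝ => x 0) ⁻¹' A) = volume A := by
  have h := (volume_preserving_funUnique (Fin 1) ℝ).measure_preimage_equiv A
  have hcoe : (⇑(MeasurableEquiv.funUnique (Fin 1) ℝ) : (Fin 1 → ℝ) → ℝ) = fun x => x 0 := rfl
  rw [hcoe] at h
  exact h

/-- The volume of `I ⊆ ℝ¹` is the length of its section. -/
theorem volume_eq_volume_section (I : Set (Fin 1 → ℝ)) :
    volume I = volume {y : ℝ | (fun _ : Fin 1 => y) ∈ I} := by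
  rw [← volume_preimage_apply_zero {y : ℝ | (fun _ : Fin 1 => y) ∈ I}]
  congr 1
  ext x
  exact mem_iff_apply_zero_mem_section I x

/-- The section of a convex subset of `ℝ¹` is order-connected (an interval). -/
theorem ordConnected_section : ∀ {I : Set (Fin 1 → ℝ)}, Convex ℝ I → {y : ℝ | (fun _ : Fin 1 => y) ∈ I}.OrdConnected := by
  intro I hI
  have hlin : IsLinearMap ℝ (fun y : ℝ => (fun _ : Fin 1 => y)) := ⟨fun _ _ => rfl, fun _ _ => rfl⟩
  exact (hI.is_linear_preimage hlin).ordConnected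

/-- The section of a subset of `[-N, N] ⊆ ℝ¹` lies in `[-N, N]`. -/
theorem section_subset_Icc {I : Set (Fin 1 → ℝ)} {N : ℕ} (hIN : I ⊆ realBox 1 N) :
    {y : ℝ | (fun _ : Fin 1 => y) ∈ I} ⊆ Set.Icc (-(N : ℝ)) N := by
  intro y hy
  have h := hIN hy
  simp only [realBox, Set.mem_Icc] at h
  exact ⟨h.1 0, h.2 0⟩

/-- A subset of `[-N, N]` has finite length. -/
theorem volume_ne_top_of_subset_Icc {J : Set ℝ} {a b : ℝ} (hJ : J ⊆ Set.Icc a b) : volume J ≠ ∞ := by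
  refine measure_ne_top_of_subset hJ ?_
  rw [Real.volume_Icc]
  exact ENNReal.ofReal_ne_top

/-! ### One-dimensional facts: slivers and the Lipschitz bound -/

/-- For an interval `J ⊆ ℝ`, the sliver `{y | y + s ∈ J, y + s' ∉ J} = (J − s) \ (J − s')` has
diameter, hence length, at most `|s − s'|`. -/
theorem volume_shift_diff_le {J : Set ℝ} (hJ : J.OrdConnected) (s s' : ℝ) :
    volume {y : ℝ | y + s ∈ J ∧ y + s' ∉ J} ≤ ENNReal.ofReal |s - s'| := by
  refine (Real.volume_le_diam _).trans (Metric.ediam_le fun y hy y' hy' => ?_)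
  rw [edist_dist, Real.dist_eq]
  apply ENNReal.ofReal_le_ofReal
  have key : ∀ z z' : ℝ, z + s ∈ J → z + s' ∉ J → z' + s ∈ J → z' + s' ∉ J → z ≤ z' →
      z' - z ≤ |s - s'| := by
    intro z z' hz hz' hw hw' _
    by_contra hcon
    have hlt := not_le.mp hcon
    rcases le_total s s' with hs | hs
    · rw [abs_of_nonpos (sub_nonpos.mpr hs)] at hlt
      exact hz' (hJ.out hz hw ⟨by linarith, by linarith⟩)
    · rw [abs_of_nonneg (sub_nonneg.mpr hs)] at hlt
      exact hw' (hJ.out hz hw ⟨by linarith, by linarith⟩)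
  rcases le_total y y' with h | h
  · rw [abs_sub_comm, abs_of_nonneg (sub_nonneg.mpr h)]
    exact key y y' hy.1 hy.2 hy'.1 hy'.2 h
  · rw [abs_of_nonneg (sub_nonneg.mpr h)]
    exact key y' y hy'.1 hy'.2 hy.1 hy.2 h

/-- One-sided comparison of the lengths of `⋂_j (J − c_j)` and `⋂_j (J − c'_j)`:
`vol(⋂ A_j) ≤ vol(⋂ B_j) + ∑_j vol(A_j \ B_j) ≤ vol(⋂ B_j) + ∑_j |c_j − c'_j|`. -/
theorem volume_sections_le_add {J : Set ℝ} (hJ : J.OrdConnected) {k : ℕ} (c c' : Fin k → ℝ) :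
    volume {y : ℝ | ∀ j, y + c j ∈ J} ≤
      volume {y : ℝ | ∀ j, y + c' j ∈ J} + ∑ j, ENNReal.ofReal |c j - c' j| := by
  calc volume {y : ℝ | ∀ j, y + c j ∈ J}
      ≤ volume ({y : ℝ | ∀ j, y + c' j ∈ J} ∪ ⋃ j, {y : ℝ | y + c j ∈ J ∧ y + c' j ∉ J}) := by
        refine measure_mono fun y hy => ?_
        by_cases h : ∀ j, y + c' j ∈ J
        · exact Or.inl h
        · obtain ⟨j, hj⟩ := not_forall.mp h
          exact Or.inr (Set.mem_iUnion.mpr ⟨j, hy j, hj⟩)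
    _ ≤ volume {y : ℝ | ∀ j, y + c' j ∈ J} + volume (⋃ j, {y : ℝ | y + c j ∈ J ∧ y + c' j ∉ J}) :=
        measure_union_le _ _
    _ ≤ volume {y : ℝ | ∀ j, y + c' j ∈ J} + ∑ j, volume {y : ℝ | y + c j ∈ J ∧ y + c' j ∉ J} := by
        gcongr
        exact measure_iUnion_fintype_le _ _
    _ ≤ volume {y : ℝ | ∀ j, y + c' j ∈ J} + ∑ j, ENNReal.ofReal |c j - c' j| := by
        gcongr with j
        exact volume_shift_diff_le hJ _ _

/-- The length of `⋂_j (J − c_j)` is `1`-Lipschitz in each shift (for an interval `J` and finite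
lengths). -/
theorem abs_toReal_volume_sections_sub_le {J : Set ℝ} (hJ : J.OrdConnected) {k : ℕ} (c c' : Fin k → ℝ)
    (hc : volume {y : ℝ | ∀ j, y + c j ∈ J} ≠ ∞) (hc' : volume {y : ℝ | ∀ j, y + c' j ∈ J} ≠ ∞) :
    |(volume {y : ℝ | ∀ j, y + c j ∈ J}).toReal - (volume {y : ℝ | ∀ j, y + c' j ∈ J}).toReal| ≤
      ∑ j, |c j - c' j| := by
  have hD : ∀ d d' : Fin k → ℝ, (∑ j, ENNReal.ofReal |d j - d' j|) ≠ ∞ :=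
    fun d d' => ENNReal.sum_ne_top.mpr fun j _ => ENNReal.ofReal_ne_top
  have hDr : ∀ d d' : Fin k → ℝ, (∑ j, ENNReal.ofReal |d j - d' j|).toReal = ∑ j, |d j - d' j| := by
    intro d d'
    rw [ENNReal.toReal_sum (fun j _ => ENNReal.ofReal_ne_top)]
    exact Finset.sum_congr rfl fun j _ => ENNReal.toReal_ofReal (abs_nonneg _)
  have h1 := ENNReal.toReal_mono (ENNReal.add_ne_top.mpr ⟨hc', hD c c'⟩) (volume_sections_le_add hJ c c')
  have h2 := ENNReal.toReal_mono (ENNReal.add_ne_top.mpr ⟨hc, hD c' c⟩) (volume_sections_le_add hJ c' c)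
  rw [ENNReal.toReal_add hc' (hD c c'), hDr] at h1
  rw [ENNReal.toReal_add hc (hD c' c), hDr] at h2
  have hsymm : ∑ j, |c' j - c j| = ∑ j, |c j - c' j| :=
    Finset.sum_congr rfl fun j _ => abs_sub_comm _ _
  rw [hsymm] at h2
  rw [abs_le]
  constructor <;> linarith

/-! ### One-dimensional facts: counting integer shifts -/

/-- For `y` in an interval `J ⊆ [-N, N]`, the number `c(y)` of integers `h ∈ [-2N, 2N]` with
`y + h ∈ J` is within `1` of the length `ℓ` of `J`: these integers form a block `p, …, q`, and
`[y + p, y + q] ⊆ J ⊆ (y + p - 1, y + q + 1)`. -/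
theorem card_shifts_bounds {J : Set ℝ} (hJ : J.OrdConnected) {N : ℕ} (hJN : J ⊆ Set.Icc (-(N : ℝ)) N)
    {y : ℝ} (hy : y ∈ J) :
    (((Finset.Icc (-(2 * N : ℤ)) (2 * N)).filter (fun h : ℤ => y + (h : ℝ) ∈ J)).card : ℝ) ≤
        (volume J).toReal + 1 ∧
      (volume J).toReal ≤
        (((Finset.Icc (-(2 * N : ℤ)) (2 * N)).filter (fun h : ℤ => y + (h : ℝ) ∈ J)).card : ℝ) + 1 := by
  have hvolJ : volume J ≠ ∞ := volume_ne_top_of_subset_Icc hJN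
  -- membership in the finite set of shifts
  have hmemT : ∀ h : ℤ, h ∈ (Finset.Icc (-(2 * N : ℤ)) (2 * N)).filter (fun h : ℤ => y + (h : ℝ) ∈ J) ↔
      y + (h : ℝ) ∈ J := by
    intro h
    rw [Finset.mem_filter, Finset.mem_Icc]
    constructor
    · exact fun h' => h'.2
    · intro hh
      refine ⟨⟨?_, ?_⟩, hh⟩
      · have h1 := hJN hy
        have h2 := hJN hh
        rw [Set.mem_Icc] at h1 h2
        have h3 : ((-(2 * N : ℤ) : ℤ) : ℝ) ≤ (h : ℝ) := by push_cast; linarith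
        exact_mod_cast h3
      · have h1 := hJN hy
        have h2 := hJN hh
        rw [Set.mem_Icc] at h1 h2
        have h3 : (h : ℝ) ≤ ((2 * N : ℤ) : ℝ) := by push_cast; linarith
        exact_mod_cast h3
  have h0T : (0 : ℤ) ∈ (Finset.Icc (-(2 * N : ℤ)) (2 * N)).filter (fun h : ℤ => y + (h : ℝ) ∈ J) :=
    (hmemT 0).2 (by simpa using hy)
  have hTne : ((Finset.Icc (-(2 * N : ℤ)) (2 * N)).filter (fun h : ℤ => y + (h : ℝ) ∈ J)).Nonempty :=
    ⟨0, h0T⟩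
  obtain ⟨p, hp⟩ : ∃ p : ℤ, ((Finset.Icc (-(2 * N : ℤ)) (2 * N)).filter
      (fun h : ℤ => y + (h : ℝ) ∈ J)).min' hTne = p := ⟨_, rfl⟩
  obtain ⟨q, hq⟩ : ∃ q : ℤ, ((Finset.Icc (-(2 * N : ℤ)) (2 * N)).filter
      (fun h : ℤ => y + (h : ℝ) ∈ J)).max' hTne = q := ⟨_, rfl⟩
  have hmin : ∀ h : ℤ, y + (h : ℝ) ∈ J → p ≤ h := fun h hh => hp ▸ Finset.min'_le _ _ ((hmemT h).2 hh)
  have hmax : ∀ h : ℤ, y + (h : ℝ) ∈ J → h ≤ q := fun h hh => hq ▸ Finset.le_max' _ _ ((hmemT h).2 hh)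
  have hpJ : y + (p : ℝ) ∈ J := (hmemT p).1 (hp ▸ Finset.min'_mem _ _)
  have hqJ : y + (q : ℝ) ∈ J := (hmemT q).1 (hq ▸ Finset.max'_mem _ _)
  have hp0 : p ≤ 0 := hmin 0 (by simpa using hy)
  have hq0 : 0 ≤ q := hmax 0 (by simpa using hy)
  -- the shifts form the block `p, …, q`
  have hTeq : (Finset.Icc (-(2 * N : ℤ)) (2 * N)).filter (fun h : ℤ => y + (h : ℝ) ∈ J) = Finset.Icc p q := by
    ext h
    rw [Finset.mem_Icc, hmemT]
    constructor
    · exact fun hh => ⟨hmin h hh, hmax h hh⟩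
    · rintro ⟨hph, hhq⟩
      have h1 : (p : ℝ) ≤ h := Int.cast_le.mpr hph
      have h2 : (h : ℝ) ≤ q := Int.cast_le.mpr hhq
      exact hJ.out hpJ hqJ ⟨by linarith, by linarith⟩
  have hcard : ((((Finset.Icc (-(2 * N : ℤ)) (2 * N)).filter (fun h : ℤ => y + (h : ℝ) ∈ J)).card : ℕ) : ℝ) =
      (q : ℝ) - p + 1 := by
    rw [hTeq, Int.card_Icc]
    have h1 : (((q + 1 - p).toNat : ℕ) : ℤ) = q + 1 - p := Int.toNat_of_nonneg (by omega)
    have h2 : (((q + 1 - p).toNat : ℕ) : ℝ) = ((q + 1 - p : ℤ) : ℝ) := by exact_mod_cast h1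
    rw [h2]
    push_cast
    ring
  rw [hcard]
  constructor
  · -- `[y + p, y + q] ⊆ J`
    have hsub : Set.Icc (y + p) (y + q) ⊆ J := hJ.out hpJ hqJ
    have h1 : ENNReal.ofReal ((q : ℝ) - p) ≤ volume J := by
      have h := measure_mono (μ := volume) hsub
      rw [Real.volume_Icc] at h
      have h' : y + (q : ℝ) - (y + p) = (q : ℝ) - p := by ring
      rwa [h'] at h
    have h2 : (q : ℝ) - p ≤ (volume J).toReal := (ENNReal.ofReal_le_iff_le_toReal hvolJ).mp h1
    linarith
  · -- `J ⊆ (y + p - 1, y + q + 1)`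
    have hq0' : (0 : ℝ) ≤ q := by exact_mod_cast hq0
    have hp0' : (p : ℝ) ≤ 0 := by exact_mod_cast hp0
    have hsub : J ⊆ Set.Ioo (y + p - 1) (y + q + 1) := by
      intro z hz
      rw [Set.mem_Ioo]
      constructor
      · by_contra hcon
        have hle := not_lt.mp hcon
        have hmem : y + ((p - 1 : ℤ) : ℝ) ∈ J := by
          push_cast
          exact hJ.out hz hy ⟨by linarith, by linarith⟩
        have := hmin (p - 1) hmem
        omega
      · by_contra hcon
        have hle := not_lt.mp hcon
        have hmem : y + ((q + 1 : ℤ) : ℝ) ∈ J := by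
          push_cast
          exact hJ.out hy hz ⟨by linarith, by linarith⟩
        have := hmax (q + 1) hmem
        omega
    have h1 : volume J ≤ ENNReal.ofReal ((q : ℝ) - p + 2) := by
      have h := measure_mono (μ := volume) hsub
      rw [Real.volume_Ioo] at h
      have h' : y + (q : ℝ) + 1 - (y + p - 1) = (q : ℝ) - p + 2 := by ring
      rwa [h'] at h
    have h2 : (volume J).toReal ≤ (q : ℝ) - p + 2 := ENNReal.toReal_le_of_le_ofReal (by linarith) h1
    linarith

/-! ### Measurability -/

/-- `⋂_j (J − c_j)` is measurable for measurable `J`. -/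
theorem measurableSet_sections {J : Set ℝ} (hJm : MeasurableSet J) {k : ℕ} (c : Fin k → ℝ) :
    MeasurableSet {y : ℝ | ∀ j, y + c j ∈ J} := by
  have h : {y : ℝ | ∀ j, y + c j ∈ J} = ⋂ j, (fun y : ℝ => y + c j) ⁻¹' J := by
    ext y
    simp only [Set.mem_setOf_eq, Set.mem_iInter, Set.mem_preimage]
  rw [h]
  exact MeasurableSet.iInter fun j => hJm.preimage (measurable_add_const (c j))

end Summit.Parity.GeneralizedHardyLittlewood.Cruxes.RelativeDimOne.TranslateAmplification
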